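import Summits.QuantumFields.BalabanUV.Beta.EriceRemainderEnclosureHistoryAutonomyThreshold

/-!
# EriceRemainderEnclosureHistoryAutonomyContinuity — (E40) CONTINUOUS DEPENDENCE WITHOUT A RATE: the box solutions of the flows with memory
# of a SEQUENCE of functionals `B_n → B` (uniformly on the box ]0,γ]^ℕ, common floor `b > 0`, common bound `U`) from pins `g_n → g_IR` have
# agewise limit points, EVERY limit point solves the limit flow (closed graph), and whenever the limit flow has a UNIQUE box solution — e.g.
# under (E38a)'s CLOSED condition `M·γ ≤ 3√3·b`, where (E38b)'s Lipschitz constant `1∕(1 − q)` degenerates — the whole sequence converges to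
# it, agewise AND uniformly in the age: upper semicontinuity of the solution set in general, continuity at every point of uniqueness

Cell `pub-balaban`, β-function sub-cell, BINDER row D4 «RemainderConst leaves for Bałaban's split» (`HOME/BINDER-OWNERS.md`; owner
lineage `b2b-balaban-beta-an4`; this file by co-owner #2 lineage `b2b-balaban-beta-d4-p2`, generation 40), β-FLOW TEAM duty (1),
FREEZE (0) honoured (def-free; node U2's `MemFlow` ∕ `drive` ∕ `memFlow_sq_le` ∕ `invSq_eq_of_memFlow`, (E38a)'s `le_inv_sqrt_of_le_inv_sq` ∕
`memFlow_unique_zs_closed` BY NAME; compactness = Tychonoff `isCompact_univ_pi` on `ℕ → ℝ`).  Companion of (E38a–c) and (E39)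
`…HistoryAutonomyExistence` (existence without smallness); imports (E38a) only.

HONEST FRAMING (page 1, verbatim and binding).  *"Discharging BetaPertH makes Bałaban's UV stability UNCONDITIONAL — a real
constructive-QFT result; it is NOT the continuum limit and NOT the Clay problem."*  THIS FILE DISCHARGES NOTHING OF THE KIND.  Pure real
analysis (compactness + closed graph) about ABSTRACT functionals with displayed floor, bound and zeroth moment; nothing of Bałaban's (1.22)
or its limit functional is asserted.  Row D4 class UNCHANGED (critical-path width 0; instance 0∕1; D4 DISCHARGE NO DATE).  HONEST DEPENDENCY:
continuum YM on T⁴ ⇐ BetaPertH ∧ nine spine estimates (0/9 proved); BetaPertH ⇐ (D1) ∧ (D4) ∧ CAP+tail; G-an2-4 gates asym, D1 and NE2/3/4.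

THE POINT.  (E37b)∕(E38b) give LIPSCHITZ dependence of the box solution on (functional, pin) with the constant `1∕(1 − q)`, `q = M·γ∕(3√3·b)`,
which is void at the closed endpoint `q = 1` although uniqueness still holds there ((E38a) `memFlow_unique_zs_closed`).  Compactness
repairs this without a rate: all box solutions of flows with floor `b` from pins in ]0,γ] lie under the envelope `hi j = (1∕γ² + j·b)^{−1∕2}`
(node U2's `memFlow_sq_le`) and above `lo j = (1∕g₀² + j·U)^{−1∕2}` when the functionals are `≤ U` and the pins `≥ g₀`; on that cube
AGEWISE convergence is UNIFORM convergence (§2: the tails are uniformly `≤ hi j → 0`), the cube is compact (Tychonoff), the graph of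
«`h` is a box solution of `(B, g_IR)`» is closed under `B_n → B` uniform on the box and `g_n → g_IR` (§3: pass to the limit in
`1∕h_n(m+1)² = 1∕h_n(m)² + B_n(h_n(m+1), …)` using the zeroth moment of the LIMIT functional only), so every sequence of solutions has
solution limit points (§4) and, under uniqueness of the limit solution, converges (`Filter.tendsto_of_subseq_tendsto`).  With (E38a): on
`M·γ ≤ 3√3·b` the unique box solution depends CONTINUOUSLY on (B, g_IR) in this sense — the AUTONOMY row's intrinsic characterisation is
stable at the threshold itself.  NOT claimed: a modulus of continuity at `q = 1`; anything printed.

WHAT IS PROVED ([folklore]; 0 `def`, 0 sorry).  §1 `invSqrt_tail_le`, `le_envelope_of_memFlow`, `drive_le_of_le`, `envelope_le_of_memFlow`,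
`abs_sub_le_envelope`.  §2 **`eventually_forall_abs_sub_le_of_agewise`** (agewise ⟹ uniform on a cube with vanishing widths).  §3
**`memFlow_of_agewise_limit`** (closed graph).  §4 `exists_agewise_convergent_subseq` (Tychonoff), **`exists_memFlow_limit_point`** (upper
semicontinuity: some subsequence converges agewise to a box solution of the limit flow), **`tendsto_of_memFlow_unique`** (uniqueness of the
limit solution ⟹ the whole sequence converges, agewise and uniformly), **`tendsto_of_ratio_le`** ((E38a)'s closed condition on the limit
functional ⟹ convergence to its unique box solution).
-/

noncomputable section
open Filter Topology Finset Set

namespace Summit.QuantumFields.BalabanUV.Beta.EriceRemainderEnclosureHistoryAutonomyContinuity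

open Literature.MathematicalPhysics.QuantumFieldTheory.Balaban1983to89
open Literature.MathematicalPhysics.QuantumFieldTheory.Balaban1983to89.T4BetaStationary
open Literature.MathematicalPhysics.QuantumFieldTheory.Balaban1983to89.T4BetaFlowWellPosed
open Summit.QuantumFields.BalabanUV.Beta.EriceRemainderEnclosureHistoryAutonomyWellPosed
open Summit.QuantumFields.BalabanUV.Beta.EriceRemainderEnclosureHistoryAutonomyThreshold

variable {B : (ℕ → ℝ) → ℝ} {Bn : ℕ → (ℕ → ℝ) → ℝ} {M γ b U g₀ gIR : ℝ} {gn η : ℕ → ℝ} {hn : ℕ → ℕ → ℝ} {h : ℕ → ℝ}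

/-! ## §1 The two envelopes of box solutions and the vanishing tail -/

/-- THE TAIL: for `b, γ > 0`, `ε > 0` there is `J` with `1∕√(1∕γ² + j·b) ≤ ε` for all `j ≥ J`. [folklore] -/
theorem invSqrt_tail_le (hb : 0 < b) {ε : ℝ} (hε : 0 < ε) :
    ∃ J : ℕ, ∀ j : ℕ, J ≤ j → 1 / Real.sqrt (1 / γ ^ 2 + (j : ℝ) * b) ≤ ε := by
  obtain ⟨J, hJ⟩ : ∃ J : ℕ, 1 / (b * ε ^ 2) < J := exists_nat_gt _
  refine ⟨J, fun j hj => ?_⟩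
  have hjJ : 1 / (b * ε ^ 2) < (j : ℝ) := hJ.trans_le (by exact_mod_cast hj)
  have hP : 1 / ε ^ 2 < 1 / γ ^ 2 + (j : ℝ) * b := by
    have h1 : 1 / ε ^ 2 < (j : ℝ) * b := by
      rw [div_lt_iff₀ (by positivity)] at hjJ
      rw [div_lt_iff₀ (by positivity)]
      linarith
    exact h1.trans_le (le_add_of_nonneg_left (by positivity))
  have hP0 : 0 < 1 / γ ^ 2 + (j : ℝ) * b := lt_trans (by positivity) hP
  rw [div_le_iff₀ (Real.sqrt_pos.2 hP0), ← div_le_iff₀' hε]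
  calc 1 / ε = Real.sqrt (1 / ε ^ 2) := by rw [← one_div_pow, Real.sqrt_sq (by positivity)]
    _ ≤ Real.sqrt (1 / γ ^ 2 + (j : ℝ) * b) := Real.sqrt_le_sqrt hP.le

/-- THE UPPER ENVELOPE of a box solution with floor `b` from a pin `gIR ≤ γ`: `h m ≤ 1∕√(1∕γ² + m·b)`. [folklore] -/
theorem le_envelope_of_memFlow (hb : 0 < b) (hgIR : 0 < gIR) (hgIRγ : gIR ≤ γ) (hlo : ∀ u, SeqBox γ u → b ≤ B u)
    (hh : SeqBox γ h) (hf : MemFlow B gIR h) (m : ℕ) : h m ≤ 1 / Real.sqrt (1 / γ ^ 2 + (m : ℝ) * b) := by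
  have hmb : (0 : ℝ) ≤ (m : ℝ) * b := mul_nonneg (Nat.cast_nonneg m) hb.le
  have hP0 : 0 < 1 / γ ^ 2 + (m : ℝ) * b := by
    have hγ : 0 < γ := lt_of_lt_of_le hgIR hgIRγ
    positivity
  have h1 := memFlow_sq_le hlo hb hgIR hh hf m
  have hpin : 1 / γ ^ 2 ≤ 1 / gIR ^ 2 := one_div_le_one_div_of_le (by positivity) (pow_le_pow_left₀ hgIR.le hgIRγ 2)
  have h2 : 1 / γ ^ 2 + (m : ℝ) * b ≤ 1 / h m ^ 2 := by
    have := one_div_le_one_div_of_le (pow_pos (hh m).1 2) h1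
    rw [one_div_one_div] at this
    exact (add_le_add hpin le_rfl).trans this
  exact le_inv_sqrt_of_le_inv_sq (hh m).1 hP0 h2

/-- The driving sums under a plain upper bound `U` of the functional on the box: `drive B h m ≤ m·U`. [folklore] -/
theorem drive_le_of_le (hU : ∀ u, SeqBox γ u → B u ≤ U) (hh : SeqBox γ h) : ∀ m : ℕ, drive B h m ≤ (m : ℝ) * U := by
  intro m
  induction m with
  | zero => simp
  | succ m ih =>
    rw [drive_succ, Nat.cast_succ, add_mul, one_mul]
    exact add_le_add ih (hU _ (seqBox_shift hh (m + 1)))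

/-- THE LOWER ENVELOPE of a box solution of a functional `≤ U` from a pin `gIR ≥ g₀ > 0`: `1∕√(1∕g₀² + m·U) ≤ h m`. [folklore] -/
theorem envelope_le_of_memFlow (hg₀ : 0 < g₀) (hg₀le : g₀ ≤ gIR) (hU : ∀ u, SeqBox γ u → B u ≤ U)
    (hh : SeqBox γ h) (hf : MemFlow B gIR h) (m : ℕ) : 1 / Real.sqrt (1 / g₀ ^ 2 + (m : ℝ) * U) ≤ h m := by
  have hS : 1 / h m ^ 2 ≤ 1 / g₀ ^ 2 + (m : ℝ) * U := by
    rw [invSq_eq_of_memFlow hf m]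
    exact add_le_add (one_div_le_one_div_of_le (by positivity) (pow_le_pow_left₀ hg₀.le hg₀le 2)) (drive_le_of_le hU hh m)
  have := one_div_sqrt_anti (by have := (hh m).1; positivity) hS
  rwa [one_div_sqrt_one_div_sq (hh m).1] at this

/-- Two points of the cube `[lo j, hi j]` with `0 ≤ lo` are `hi j`-close. [folklore] -/
theorem abs_sub_le_envelope {lo hi : ℕ → ℝ} (hlo : ∀ j, 0 ≤ lo j) {u v : ℕ → ℝ} (hu : ∀ j, lo j ≤ u j ∧ u j ≤ hi j)
    (hv : ∀ j, lo j ≤ v j ∧ v j ≤ hi j) (j : ℕ) : |u j - v j| ≤ hi j :=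
  abs_sub_le_of_nonneg_of_le ((hlo j).trans (hu j).1) (hu j).2 ((hlo j).trans (hv j).1) (hv j).2

/-! ## §2 On a cube with vanishing widths, agewise convergence is uniform convergence -/

/-- **AGEWISE ⟹ UNIFORM** on a cube with vanishing widths: if `|hn n j − h j| ≤ hi j` for all `n, j`, `hi j ≤ ε` beyond `J(ε)`, and
`hn n j → h j` for every age `j`, then for every `ε > 0` eventually `|hn n j − h j| ≤ ε` for ALL `j` at once. [folklore] -/
theorem eventually_forall_abs_sub_le_of_agewise {hi : ℕ → ℝ} (henv : ∀ n j, |hn n j - h j| ≤ hi j)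
    (htail : ∀ ε : ℝ, 0 < ε → ∃ J : ℕ, ∀ j : ℕ, J ≤ j → hi j ≤ ε)
    (hpt : ∀ j, Tendsto (fun n => hn n j) atTop (𝓝 (h j))) {ε : ℝ} (hε : 0 < ε) :
    ∀ᶠ n in atTop, ∀ j, |hn n j - h j| ≤ ε := by
  obtain ⟨J, hJ⟩ := htail ε hε
  have hev : ∀ᶠ n in atTop, ∀ j ∈ Finset.range J, dist (hn n j) (h j) < ε :=
    (Filter.eventually_all_finset _).2 fun j _ => Metric.tendsto_nhds.1 (hpt j) ε hε
  refine hev.mono fun n hnJ j => ?_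
  by_cases hj : j < J
  · have := hnJ j (Finset.mem_range.2 hj)
    rw [Real.dist_eq] at this
    exact this.le
  · exact (henv n j).trans (hJ j (not_lt.1 hj))

/-! ## §3 The closed graph: agewise limits of box solutions solve the limit flow -/

/-- **CLOSED GRAPH.**  Functionals `B_n` with common floor `b > 0` on ]0,γ]^ℕ converging to `B` UNIFORMLY on the box (`|B_n u − B u| ≤ η_n`,
`η_n → 0`), `B` with a zeroth moment `M`; pins `g_n ∈ ]0,γ]` with `g_n → g_IR`; box solutions `h_n` of `(B_n, g_n)` converging AGEWISE to
a box history `h`.  Then `h` is a box solution of `(B, g_IR)`.  (The tails `≤ (1∕γ² + j·b)^{−1∕2}` make the convergence uniform, so the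
zeroth moment of `B` passes the histories to the limit inside `B`; `1∕x²` is continuous at the positive limits.) [folklore] -/
theorem memFlow_of_agewise_limit (hb : 0 < b)
    (hBM : ∀ u u' : ℕ → ℝ, SeqBox γ u → SeqBox γ u' → ∀ D : ℝ, (∀ j, |u j - u' j| ≤ D) → |B u - B u'| ≤ M * D)
    (hM : 0 ≤ M) (hlon : ∀ n u, SeqBox γ u → b ≤ Bn n u) (hη : ∀ n u, SeqBox γ u → |Bn n u - B u| ≤ η n)
    (hη0 : Tendsto η atTop (𝓝 0)) (hgn : ∀ n, 0 < gn n ∧ gn n ≤ γ) (hg : Tendsto gn atTop (𝓝 gIR))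
    (hhn : ∀ n, SeqBox γ (hn n)) (hfn : ∀ n, MemFlow (Bn n) (gn n) (hn n)) (hh : SeqBox γ h)
    (hpt : ∀ j, Tendsto (fun n => hn n j) atTop (𝓝 (h j))) : MemFlow B gIR h := by
  -- the common envelope and uniform convergence
  set hi : ℕ → ℝ := fun j => 1 / Real.sqrt (1 / γ ^ 2 + (j : ℝ) * b) with hhi
  have henvn : ∀ n j, hn n j ≤ hi j := fun n j => le_envelope_of_memFlow hb (hgn n).1 (hgn n).2 (hlon n) (hhn n) (hfn n) j
  have henvh : ∀ j, h j ≤ hi j := fun j => le_of_tendsto' (hpt j) fun n => henvn n j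
  have hclose : ∀ n j, |hn n j - h j| ≤ hi j := fun n j =>
    abs_sub_le_of_nonneg_of_le (hhn n j).1.le (henvn n j) (hh j).1.le (henvh j)
  have hunif : ∀ ε : ℝ, 0 < ε → ∀ᶠ n in atTop, ∀ j, |hn n j - h j| ≤ ε := fun ε hε =>
    eventually_forall_abs_sub_le_of_agewise hclose (fun ε' hε' => invSqrt_tail_le (γ := γ) hb hε') hpt hε
  refine ⟨?_, fun m => ?_⟩
  · -- the pin
    have h0 : Tendsto (fun n => hn n 0) atTop (𝓝 gIR) := by
      have : (fun n => hn n 0) = gn := funext fun n => (hfn n).1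
      rw [this]; exact hg
    exact tendsto_nhds_unique (hpt 0) h0
  · -- the step at scale m: pass to the limit in `1/h_n(m+1)² = 1/h_n(m)² + B_n (h_n(m+1+·))`
    have hinv : ∀ k, Tendsto (fun n => 1 / hn n k ^ 2) atTop (𝓝 (1 / h k ^ 2)) := fun k => by
      have t := ((hpt k).pow 2).inv₀ (pow_ne_zero 2 (hh k).1.ne')
      simpa only [one_div] using t
    have hBlim : Tendsto (fun n => Bn n (fun j => hn n (m + 1 + j))) atTop (𝓝 (B (fun j => h (m + 1 + j)))) := by
      rw [Metric.tendsto_nhds]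
      intro ε hε
      have hε' : 0 < ε / (2 * (M + 1)) := by positivity
      have hη' : ∀ᶠ n in atTop, |η n| < ε / 2 := by
        have := Metric.tendsto_nhds.1 hη0 (ε / 2) (half_pos hε)
        simpa [Real.dist_eq] using this
      filter_upwards [hunif _ hε', hη'] with n hn1 hn2
      rw [Real.dist_eq]
      have t1 : |Bn n (fun j => hn n (m + 1 + j)) - B (fun j => hn n (m + 1 + j))| ≤ η n :=
        hη n _ (seqBox_shift (hhn n) (m + 1))
      have t2 : |B (fun j => hn n (m + 1 + j)) - B (fun j => h (m + 1 + j))| ≤ M * (ε / (2 * (M + 1))) :=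
        hBM _ _ (seqBox_shift (hhn n) (m + 1)) (seqBox_shift hh (m + 1)) _ fun j => hn1 (m + 1 + j)
      have t3 : M * (ε / (2 * (M + 1))) < ε / 2 := by
        rw [show M * (ε / (2 * (M + 1))) = ε / 2 * (M / (M + 1)) by field_simp]
        exact mul_lt_of_lt_one_right (half_pos hε) ((div_lt_one (by linarith)).2 (by linarith))
      calc |Bn n (fun j => hn n (m + 1 + j)) - B (fun j => h (m + 1 + j))|
          = |(Bn n (fun j => hn n (m + 1 + j)) - B (fun j => hn n (m + 1 + j)))
              + (B (fun j => hn n (m + 1 + j)) - B (fun j => h (m + 1 + j)))| := by ring_nf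
        _ ≤ |Bn n (fun j => hn n (m + 1 + j)) - B (fun j => hn n (m + 1 + j))|
              + |B (fun j => hn n (m + 1 + j)) - B (fun j => h (m + 1 + j))| := abs_add_le _ _
        _ < ε / 2 + ε / 2 := add_lt_add (t1.trans_lt ((le_abs_self _).trans_lt hn2)) (t2.trans_lt t3)
        _ = ε := by ring
    have hlhs : Tendsto (fun n => 1 / hn n (m + 1) ^ 2) atTop (𝓝 (1 / h m ^ 2 + B (fun j => h (m + 1 + j)))) := by
      have : (fun n => 1 / hn n (m + 1) ^ 2) = fun n => 1 / hn n m ^ 2 + Bn n (fun j => hn n (m + 1 + j)) :=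
        funext fun n => (hfn n).2 m
      rw [this]
      exact (hinv m).add hBlim
    exact tendsto_nhds_unique (hinv (m + 1)) hlhs

/-! ## §4 Compactness: limit points exist; under uniqueness the whole sequence converges -/

/-- TYCHONOFF ON THE CUBE: a sequence of histories in `∏_j [lo j, hi j]` has an AGEWISE convergent subsequence with limit in the cube.
[folklore] -/
theorem exists_agewise_convergent_subseq {lo hi : ℕ → ℝ} (hmem : ∀ n j, lo j ≤ hn n j ∧ hn n j ≤ hi j) :
    ∃ h : ℕ → ℝ, (∀ j, lo j ≤ h j ∧ h j ≤ hi j) ∧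
      ∃ φ : ℕ → ℕ, StrictMono φ ∧ ∀ j, Tendsto (fun n => hn (φ n) j) atTop (𝓝 (h j)) := by
  have hK : IsCompact (Set.pi Set.univ fun j : ℕ => Set.Icc (lo j) (hi j)) := isCompact_univ_pi fun j => isCompact_Icc
  obtain ⟨h, hhK, φ, hφ, hlim⟩ := hK.tendsto_subseq (x := hn) fun n => fun j _ => ⟨(hmem n j).1, (hmem n j).2⟩
  refine ⟨h, fun j => ?_, φ, hφ, fun j => ?_⟩
  · exact hhK j (Set.mem_univ j)
  · exact (tendsto_pi_nhds.1 hlim) j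

/-- **UPPER SEMICONTINUITY OF THE SOLUTION SET.**  Under the hypotheses of `memFlow_of_agewise_limit` on the functionals and pins, plus a
common bound `B_n ≤ U` on the box and a common lower bound `g₀ ≤ g_n` of the pins: every sequence of box solutions `h_n` of `(B_n, g_n)` has
a subsequence converging AGEWISE to a box solution of the limit flow `(B, g_IR)`. [folklore] -/
theorem exists_memFlow_limit_point (hb : 0 < b) (hγ : 0 < γ)
    (hBM : ∀ u u' : ℕ → ℝ, SeqBox γ u → SeqBox γ u' → ∀ D : ℝ, (∀ j, |u j - u' j| ≤ D) → |B u - B u'| ≤ M * D)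
    (hM : 0 ≤ M) (hlon : ∀ n u, SeqBox γ u → b ≤ Bn n u) (hUn : ∀ n u, SeqBox γ u → Bn n u ≤ U)
    (hη : ∀ n u, SeqBox γ u → |Bn n u - B u| ≤ η n) (hη0 : Tendsto η atTop (𝓝 0))
    (hg₀ : 0 < g₀) (hgn : ∀ n, g₀ ≤ gn n ∧ gn n ≤ γ) (hg : Tendsto gn atTop (𝓝 gIR))
    (hhn : ∀ n, SeqBox γ (hn n)) (hfn : ∀ n, MemFlow (Bn n) (gn n) (hn n)) :
    ∃ h : ℕ → ℝ, SeqBox γ h ∧ MemFlow B gIR h ∧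
      ∃ φ : ℕ → ℕ, StrictMono φ ∧ ∀ j, Tendsto (fun n => hn (φ n) j) atTop (𝓝 (h j)) := by
  have hU0 : 0 ≤ U := by
    have := (hlon 0 _ (seqBox_const hγ)).trans (hUn 0 _ (seqBox_const hγ)); linarith
  set lo : ℕ → ℝ := fun j => 1 / Real.sqrt (1 / g₀ ^ 2 + (j : ℝ) * U) with hlo_def
  set hi : ℕ → ℝ := fun j => 1 / Real.sqrt (1 / γ ^ 2 + (j : ℝ) * b) with hhi_def
  have hgn' : ∀ n, 0 < gn n ∧ gn n ≤ γ := fun n => ⟨hg₀.trans_le (hgn n).1, (hgn n).2⟩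
  have hmem : ∀ n j, lo j ≤ hn n j ∧ hn n j ≤ hi j := fun n j =>
    ⟨envelope_le_of_memFlow hg₀ (hgn n).1 (hUn n) (hhn n) (hfn n) j,
      le_envelope_of_memFlow hb (hgn' n).1 (hgn' n).2 (hlon n) (hhn n) (hfn n) j⟩
  have hlo0 : ∀ j, 0 < lo j := fun j => by
    have : (0 : ℝ) ≤ (j : ℝ) * U := mul_nonneg (Nat.cast_nonneg j) hU0
    positivity
  have hhiγ : ∀ j, hi j ≤ γ := fun j => one_div_sqrt_le hγ (le_add_of_nonneg_right (mul_nonneg (Nat.cast_nonneg j) hb.le))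
  obtain ⟨h, hcube, φ, hφ, hlim⟩ := exists_agewise_convergent_subseq hmem
  have hh : SeqBox γ h := fun j => ⟨(hlo0 j).trans_le (hcube j).1, (hcube j).2.trans (hhiγ j)⟩
  refine ⟨h, hh, ?_, φ, hφ, hlim⟩
  exact memFlow_of_agewise_limit (Bn := fun n => Bn (φ n)) (gn := fun n => gn (φ n)) (η := fun n => η (φ n))
    (hn := fun n => hn (φ n)) hb hBM hM (fun n => hlon (φ n)) (fun n => hη (φ n)) (hη0.comp hφ.tendsto_atTop)
    (fun n => hgn' (φ n)) (hg.comp hφ.tendsto_atTop) (fun n => hhn (φ n)) (fun n => hfn (φ n)) hh hlim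

/-- **CONTINUITY AT EVERY POINT OF UNIQUENESS.**  If, in addition, the limit flow `(B, g_IR)` has AT MOST ONE box solution, then the WHOLE
sequence `h_n` converges — agewise and UNIFORMLY in the age — to a box solution `h` of `(B, g_IR)` (which therefore exists).  Every
subsequence has a sub-subsequence converging to a solution (`exists_memFlow_limit_point`), and all these limits coincide
(`Filter.tendsto_of_subseq_tendsto` in `ℕ → ℝ`). [folklore] -/
theorem tendsto_of_memFlow_unique (hb : 0 < b) (hγ : 0 < γ)
    (hBM : ∀ u u' : ℕ → ℝ, SeqBox γ u → SeqBox γ u' → ∀ D : ℝ, (∀ j, |u j - u' j| ≤ D) → |B u - B u'| ≤ M * D)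
    (hM : 0 ≤ M) (hlon : ∀ n u, SeqBox γ u → b ≤ Bn n u) (hUn : ∀ n u, SeqBox γ u → Bn n u ≤ U)
    (hη : ∀ n u, SeqBox γ u → |Bn n u - B u| ≤ η n) (hη0 : Tendsto η atTop (𝓝 0))
    (hg₀ : 0 < g₀) (hgn : ∀ n, g₀ ≤ gn n ∧ gn n ≤ γ) (hg : Tendsto gn atTop (𝓝 gIR)) (hgIR : 0 < gIR)
    (hhn : ∀ n, SeqBox γ (hn n)) (hfn : ∀ n, MemFlow (Bn n) (gn n) (hn n))
    (huniq : ∀ u u' : ℕ → ℝ, SeqBox γ u → SeqBox γ u' → MemFlow B gIR u → MemFlow B gIR u' → u = u') :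
    ∃ h : ℕ → ℝ, SeqBox γ h ∧ MemFlow B gIR h ∧ (∀ j, Tendsto (fun n => hn n j) atTop (𝓝 (h j))) ∧
      ∀ ε : ℝ, 0 < ε → ∀ᶠ n in atTop, ∀ j, |hn n j - h j| ≤ ε := by
  obtain ⟨h, hh, hf, -⟩ := exists_memFlow_limit_point hb hγ hBM hM hlon hUn hη hη0 hg₀ hgn hg hhn hfn
  -- full convergence in the product topology
  have hfull : Tendsto hn atTop (𝓝 h) := by
    refine Filter.tendsto_of_subseq_tendsto fun ns hns => ?_
    obtain ⟨h', hh', hf', ms, hms, hlim'⟩ := exists_memFlow_limit_point (Bn := fun n => Bn (ns n)) (gn := fun n => gn (ns n))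
      (η := fun n => η (ns n)) (hn := fun n => hn (ns n)) hb hγ hBM hM (fun n => hlon (ns n)) (fun n => hUn (ns n))
      (fun n => hη (ns n)) (hη0.comp hns) hg₀ (fun n => hgn (ns n)) (hg.comp hns) (fun n => hhn (ns n))
      (fun n => hfn (ns n))
    have heq : h' = h := huniq h' h hh' hh hf' hf
    refine ⟨ms, tendsto_pi_nhds.2 fun j => ?_⟩
    rw [← heq]
    exact hlim' j
  have hpt : ∀ j, Tendsto (fun n => hn n j) atTop (𝓝 (h j)) := fun j => (tendsto_pi_nhds.1 hfull) j
  refine ⟨h, hh, hf, hpt, fun ε hε => ?_⟩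
  have hgn' : ∀ n, 0 < gn n ∧ gn n ≤ γ := fun n => ⟨hg₀.trans_le (hgn n).1, (hgn n).2⟩
  have hclose : ∀ n j, |hn n j - h j| ≤ 1 / Real.sqrt (1 / γ ^ 2 + (j : ℝ) * b) := fun n j =>
    abs_sub_le_of_nonneg_of_le (hhn n j).1.le (le_envelope_of_memFlow hb (hgn' n).1 (hgn' n).2 (hlon n) (hhn n) (hfn n) j)
      (hh j).1.le (le_envelope_of_memFlow hb hgIR (le_of_tendsto' hg fun n => (hgn n).2) (fun u hu => ?_) hh hf j)
  · exact eventually_forall_abs_sub_le_of_agewise hclose (fun ε' hε' => invSqrt_tail_le (γ := γ) hb hε') hpt hε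
  · -- the limit functional inherits the floor
    have := fun n => hlon n u hu
    have hlim : Tendsto (fun n => Bn n u) atTop (𝓝 (B u)) := by
      rw [Metric.tendsto_nhds]; intro δ hδ
      have := Metric.tendsto_nhds.1 hη0 δ hδ
      filter_upwards [this] with n hn1
      rw [Real.dist_eq]
      rw [Real.dist_eq, sub_zero] at hn1
      exact (hη n u hu).trans_lt ((le_abs_self _).trans_lt hn1)
    exact ge_of_tendsto' hlim this

/-- **CONTINUITY ON THE CLOSED THRESHOLD.**  If the limit functional has zeroth moment `M` and floor `b` with `M·γ ≤ 3√3·b` ((E38a)'s CLOSED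
condition — where (E38b)'s Lipschitz constant is void), then box solutions of `(B_n, g_n)` converge, agewise and uniformly in the age, to
the unique box solution of `(B, g_IR)`: continuous dependence with NO rate at the threshold itself. [folklore] -/
theorem tendsto_of_ratio_le (hb : 0 < b) (hγ : 0 < γ)
    (hBM : ∀ u u' : ℕ → ℝ, SeqBox γ u → SeqBox γ u' → ∀ D : ℝ, (∀ j, |u j - u' j| ≤ D) → |B u - B u'| ≤ M * D)
    (hM : 0 ≤ M) (hloB : ∀ u, SeqBox γ u → b ≤ B u) (hsmall : M * γ ≤ 3 * Real.sqrt 3 * b)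
    (hlon : ∀ n u, SeqBox γ u → b ≤ Bn n u) (hUn : ∀ n u, SeqBox γ u → Bn n u ≤ U)
    (hη : ∀ n u, SeqBox γ u → |Bn n u - B u| ≤ η n) (hη0 : Tendsto η atTop (𝓝 0))
    (hg₀ : 0 < g₀) (hgn : ∀ n, g₀ ≤ gn n ∧ gn n ≤ γ) (hg : Tendsto gn atTop (𝓝 gIR)) (hgIR : 0 < gIR) (hgIRγ : gIR ≤ γ)
    (hhn : ∀ n, SeqBox γ (hn n)) (hfn : ∀ n, MemFlow (Bn n) (gn n) (hn n)) :
    ∃ h : ℕ → ℝ, SeqBox γ h ∧ MemFlow B gIR h ∧ (∀ j, Tendsto (fun n => hn n j) atTop (𝓝 (h j))) ∧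
      ∀ ε : ℝ, 0 < ε → ∀ᶠ n in atTop, ∀ j, |hn n j - h j| ≤ ε :=
  tendsto_of_memFlow_unique hb hγ hBM hM hlon hUn hη hη0 hg₀ hgn hg hgIR hhn hfn
    fun _ _ hu hu' hfu hfu' => memFlow_unique_zs_closed hBM hM hgIR hgIRγ hb hloB hsmall hu hu' hfu hfu'

end Summit.QuantumFields.BalabanUV.Beta.EriceRemainderEnclosureHistoryAutonomyContinuity

end
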